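import Literature.Computability.AlgebraicComplexity.QuantumFunctionals
import Literature.Probability.Entropy.FiniteShannon
import HarnessLib

/-!
# A modulus of continuity for the Shannon entropy (in bits) in the sup distance — proved

Topic `Literature/Computability/AlgebraicComplexity`.  The proof of Theorem 5.3 of Vassilevska
Williams–Xu–Xu–Zhou (SODA 2024, arXiv:2307.07970, p. 19) uses that the exponent
`A₁E₁ + A₂E₂ + A₃E₃` of Prop. 5.1 — a combination of Shannon entropies of (averages of) the complete
split distributions — "is continuous with respect to `{β_{W,i,j,k}}`, and because the `L_∞` distance
between `{β}` and `{ξ}` is at most `ε`, we get that `A₁E₁' + A₂E₂' + A₃E₃' ≥ A₁E₁ + A₂E₂ + A₃E₃ − o_{1/ε}(1)`".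
This file makes the `o_{1/ε}(1)` explicit for the tree's `shannonEntropy` (`H(P) = ∑ −P log₂ P`):

* `abs_shannonEntropy_sub_le` — **`|H(P) − H(Q)| ≤ |α| · (φ(δ) + δ) / log 2`** for `0 ≤ P, Q ≤ 1`
  pointwise with `|P − Q| ≤ δ ≤ 1` pointwise (`φ(u) = −u log u`), from the pointwise modulus
  `|φ(p) − φ(q)| ≤ φ(|p − q|) + |p − q|` of `Literature/Probability/Entropy/FiniteShannon.lean`;
* `shannonEntropy_sub_le_of_abs_sub_le`, `le_shannonEntropy_add_of_abs_sub_le` — the two one-sided forms;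
* `entropyModulus`, `entropyModulus_nonneg`, `entropyModulus_mono`, `tendsto_entropyModulus` —
  the modulus `m(δ) = (φ(δ) + δ)/log 2` is `≥ 0` on `[0,1]`, monotone on `[0, e⁻¹]` and tends to `0`
  as `δ → 0` (so `|α| · m(ε)` is an admissible `o_{1/ε}(1)`).

Everything is proved; the one definition is the modulus; no named facts.

## References

* V. Vassilevska Williams, Y. Xu, Z. Xu, R. Zhou, *New bounds for matrix multiplication: from alpha
  to omega*, SODA 2024, arXiv:2307.07970 (held: `paper:arxiv-2307.07970`), Thm. 5.3 (proof,
  continuity step). [VassilevskaWilliamsXuXuZhou2024]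
* T. M. Cover, J. A. Thomas, *Elements of Information Theory*, 2nd ed., Wiley 2006, Thm. 17.3.3
  (`L₁` bound on entropy differences). [CoverThomas2006]
-/

noncomputable section

open scoped BigOperators Topology
open Finset Real

namespace Literature.Computability.AlgebraicComplexity

open Literature.Probability.Entropy.FiniteShannon (abs_negMulLog_sub_le negMulLog_sub_negMulLog_add_le)

variable {α : Type*} [Fintype α]

/-- **The entropy modulus** `m(δ) = (φ(δ) + δ) / log 2`, `φ(u) = −u log u`: the per-letter modulus of
continuity of the Shannon entropy in bits. [folklore] -/
def entropyModulus (δ : ℝ) : ℝ := (negMulLog δ + δ) / Real.log 2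

/-- Unfolding. [folklore] -/
theorem entropyModulus_def (δ : ℝ) : entropyModulus δ = (negMulLog δ + δ) / Real.log 2 := rfl

/-- `m(0) = 0`. [folklore] -/
@[simp] theorem entropyModulus_zero : entropyModulus 0 = 0 := by simp [entropyModulus]

/-- `m(δ) ≥ 0` for `0 ≤ δ ≤ 1`. [folklore] -/
theorem entropyModulus_nonneg {δ : ℝ} (h0 : 0 ≤ δ) (h1 : δ ≤ 1) : 0 ≤ entropyModulus δ :=
  div_nonneg (add_nonneg (negMulLog_nonneg h0 h1) h0) (Real.log_nonneg one_le_two)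

/-- `m` is monotone on `[0, 1]` in the weak form `m(u) ≤ m(δ) + 0` for `u ≤ δ ≤ 1`:
`φ(u) + u ≤ φ(δ) + δ` (from `φ(u) − φ(δ) ≤ δ − u`). [folklore] -/
theorem entropyModulus_mono {u δ : ℝ} (hu : 0 ≤ u) (hle : u ≤ δ) (h1 : δ ≤ 1) :
    entropyModulus u ≤ entropyModulus δ := by
  unfold entropyModulus
  refine div_le_div_of_nonneg_right ?_ (Real.log_nonneg one_le_two)
  have h := negMulLog_sub_negMulLog_add_le hu (sub_nonneg.2 hle) (by linarith)
  rw [add_sub_cancel] at h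
  linarith

/-- **`m(δ) → 0` as `δ → 0`** (`φ` is continuous with `φ(0) = 0`). [folklore] -/
theorem tendsto_entropyModulus : Filter.Tendsto entropyModulus (𝓝 0) (𝓝 0) := by
  have h : Continuous entropyModulus :=
    (continuous_negMulLog.add continuous_id).div_const _
  simpa using h.tendsto 0

/-- **For every `η > 0` there is `ε₀ > 0` with `C · m(ε) ≤ η` for all `0 ≤ ε ≤ ε₀`** (the form in which
the `o_{1/ε}(1)` is consumed). [folklore] -/
theorem exists_entropyModulus_le {C η : ℝ} (hC : 0 ≤ C) (hη : 0 < η) :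
    ∃ ε₀ : ℝ, 0 < ε₀ ∧ ∀ ε, 0 ≤ ε → ε ≤ ε₀ → C * entropyModulus ε ≤ η := by
  have ht := tendsto_entropyModulus
  rw [Metric.tendsto_nhds_nhds] at ht
  obtain ⟨d, hd, hdε⟩ := ht (η / (C + 1)) (by positivity)
  refine ⟨min (d / 2) 1, by positivity, fun ε h0 hε => ?_⟩
  have hεd : dist ε 0 < d := by
    rw [Real.dist_eq, sub_zero, abs_of_nonneg h0]
    have := min_le_left (d / 2) 1
    linarith
  have h := hdε hεd
  rw [Real.dist_eq, sub_zero] at h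
  have hm : entropyModulus ε < η / (C + 1) := lt_of_abs_lt h
  have hm0 : 0 ≤ entropyModulus ε := entropyModulus_nonneg h0 (hε.trans (min_le_right _ _))
  calc C * entropyModulus ε ≤ (C + 1) * entropyModulus ε := by nlinarith
    _ ≤ (C + 1) * (η / (C + 1)) := by
        exact mul_le_mul_of_nonneg_left hm.le (by positivity)
    _ = η := by field_simp

/-- **Continuity of the Shannon entropy in the sup distance, quantitative**: for `0 ≤ P, Q ≤ 1`
pointwise with `|P x − Q x| ≤ δ ≤ 1` for all `x`,
`|H(P) − H(Q)| ≤ |α| · (φ(δ) + δ) / log 2 = |α| · m(δ)`.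
[cite: VassilevskaWilliamsXuXuZhou2024, Thm. 5.3 (proof: "A₁E₁ + A₂E₂ + A₃E₃ is continuous with respect to {β}")] -/
theorem abs_shannonEntropy_sub_le {P Q : α → ℝ} (hP0 : ∀ x, 0 ≤ P x) (hP1 : ∀ x, P x ≤ 1)
    (hQ0 : ∀ x, 0 ≤ Q x) (hQ1 : ∀ x, Q x ≤ 1) {δ : ℝ} (hδ1 : δ ≤ 1) (hclose : ∀ x, |P x - Q x| ≤ δ) :
    |shannonEntropy P - shannonEntropy Q| ≤ Fintype.card α * entropyModulus δ := by
  rcases isEmpty_or_nonempty α with hα | ⟨⟨x₀⟩⟩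
  · simp [shannonEntropy_def, entropyModulus]
  have hδ0 : 0 ≤ δ := (abs_nonneg _).trans (hclose x₀)
  have hlog : 0 < Real.log 2 := Real.log_pos one_lt_two
  rw [shannonEntropy_def, shannonEntropy_def, ← sub_div, ← sum_sub_distrib, abs_div, abs_of_pos hlog,
    entropyModulus, mul_div_assoc']
  refine div_le_div_of_nonneg_right ?_ hlog.le
  refine (abs_sum_le_sum_abs _ _).trans ?_
  calc ∑ x, |negMulLog (P x) - negMulLog (Q x)| ≤ ∑ _x : α, (negMulLog δ + δ) := by
        refine sum_le_sum fun x _ => ?_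
        refine (abs_negMulLog_sub_le (hP0 x) (hP1 x) (hQ0 x) (hQ1 x)).trans ?_
        have hx := hclose x
        have hx0 : 0 ≤ |P x - Q x| := abs_nonneg _
        have h := negMulLog_sub_negMulLog_add_le hx0 (sub_nonneg.2 hx) (by linarith)
        rw [add_sub_cancel] at h
        linarith
    _ = Fintype.card α * (negMulLog δ + δ) := by rw [sum_const, nsmul_eq_mul, card_univ]

/-- One-sided form: `H(P) ≤ H(Q) + |α| m(δ)`. [cite: VassilevskaWilliamsXuXuZhou2024, Thm. 5.3 (proof)] -/
theorem shannonEntropy_sub_le_of_abs_sub_le {P Q : α → ℝ} (hP0 : ∀ x, 0 ≤ P x) (hP1 : ∀ x, P x ≤ 1)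
    (hQ0 : ∀ x, 0 ≤ Q x) (hQ1 : ∀ x, Q x ≤ 1) {δ : ℝ} (hδ1 : δ ≤ 1) (hclose : ∀ x, |P x - Q x| ≤ δ) :
    shannonEntropy P ≤ shannonEntropy Q + Fintype.card α * entropyModulus δ := by
  have h := abs_shannonEntropy_sub_le hP0 hP1 hQ0 hQ1 hδ1 hclose
  rw [abs_le] at h
  linarith [h.2]

/-- One-sided form: `H(Q) − |α| m(δ) ≤ H(P)`. [cite: VassilevskaWilliamsXuXuZhou2024, Thm. 5.3 (proof)] -/
theorem le_shannonEntropy_add_of_abs_sub_le {P Q : α → ℝ} (hP0 : ∀ x, 0 ≤ P x) (hP1 : ∀ x, P x ≤ 1)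
    (hQ0 : ∀ x, 0 ≤ Q x) (hQ1 : ∀ x, Q x ≤ 1) {δ : ℝ} (hδ1 : δ ≤ 1) (hclose : ∀ x, |P x - Q x| ≤ δ) :
    shannonEntropy Q - Fintype.card α * entropyModulus δ ≤ shannonEntropy P := by
  have h := abs_shannonEntropy_sub_le hP0 hP1 hQ0 hQ1 hδ1 hclose
  rw [abs_le] at h
  linarith [h.1]

/-- **Weighted form** (for the `λ`-terms `∑_S (|S|/n) H(γ_S)` of Prop. 5.1): if `0 ≤ w_s` with
`∑ w_s ≤ 1` and every pair `P_s, Q_s` is as above, then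
`|∑ w_s H(P_s) − ∑ w_s H(Q_s)| ≤ |α| m(δ)`. [cite: VassilevskaWilliamsXuXuZhou2024, Thm. 5.3 (proof) and §5 (λ_Z)] -/
theorem abs_sum_mul_shannonEntropy_sub_le {ι : Type*} (s : Finset ι) {w : ι → ℝ} (hw : ∀ i ∈ s, 0 ≤ w i)
    (hw1 : ∑ i ∈ s, w i ≤ 1) {P Q : ι → α → ℝ} (hP0 : ∀ i ∈ s, ∀ x, 0 ≤ P i x) (hP1 : ∀ i ∈ s, ∀ x, P i x ≤ 1)
    (hQ0 : ∀ i ∈ s, ∀ x, 0 ≤ Q i x) (hQ1 : ∀ i ∈ s, ∀ x, Q i x ≤ 1) {δ : ℝ} (hδ0 : 0 ≤ δ) (hδ1 : δ ≤ 1)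
    (hclose : ∀ i ∈ s, ∀ x, |P i x - Q i x| ≤ δ) :
    |∑ i ∈ s, w i * shannonEntropy (P i) - ∑ i ∈ s, w i * shannonEntropy (Q i)| ≤
      Fintype.card α * entropyModulus δ := by
  have hm0 : 0 ≤ Fintype.card α * entropyModulus δ :=
    mul_nonneg (Nat.cast_nonneg _) (entropyModulus_nonneg hδ0 hδ1)
  rw [← sum_sub_distrib]
  refine (abs_sum_le_sum_abs _ _).trans ?_
  calc ∑ i ∈ s, |w i * shannonEntropy (P i) - w i * shannonEntropy (Q i)|
      ≤ ∑ i ∈ s, w i * (Fintype.card α * entropyModulus δ) := by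
        refine sum_le_sum fun i hi => ?_
        rw [← mul_sub, abs_mul, abs_of_nonneg (hw i hi)]
        exact mul_le_mul_of_nonneg_left
          (abs_shannonEntropy_sub_le (hP0 i hi) (hP1 i hi) (hQ0 i hi) (hQ1 i hi) hδ1 (hclose i hi)) (hw i hi)
    _ = (∑ i ∈ s, w i) * (Fintype.card α * entropyModulus δ) := by rw [sum_mul]
    _ ≤ 1 * (Fintype.card α * entropyModulus δ) := mul_le_mul_of_nonneg_right hw1 hm0
    _ = Fintype.card α * entropyModulus δ := one_mul _

end Literature.Computability.AlgebraicComplexity
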